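import Summits.AtomisticToContinuum.Crystallization.Theorems.PalmUnimodularRigidityLayeredLawsSelectHcpDefs
import Summits.AtomisticToContinuum.Crystallization.Theorems.ExcessDecayLiouvilleForceBalance
import Summits.AtomisticToContinuum.Crystallization.Theorems.PhononStability.Negative.Mirror
import Literature.MathematicalPhysics.StatisticalMechanics.MuGSC

/-!
# Crux `LayeredLawsSelectHcp` (stmt-AtomisticToContinuum-9226), line `mtp-prestress-split-ergodic-frame`:
# a hard-core Sütő `μ`-ground-state configuration of Lennard-Jones is in force balance at every point

Registered sub-goal `tube_muGSC_forceBalance` of the crux item (deterministic first-order structure of almost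
every sample of a minimising layered law, via the landed `tube_ae_isMuGSC`): if `S ⊂ ℝ³` is `δ`-separated
(`δ > 0`) and a `μ`GSC of Lennard-Jones at ANY chemical potential `μc` (`IsMuGSC lennardJones μc S`), then at every
`p ∈ S` the total force vanishes,
`Σ_{q ∈ S, q ≠ p} V′(|p − q|)·(p − q)/|p − q| = 0` (`HasSum` over the subtype, absolutely convergent by the `r⁻⁷`
decay and shell counting) — the `Equil` predicate of route `ExcessDecayLiouville`, for INFINITE configurations.
Proof (Fermat): the exchange test of the `μ`GSC with one particle moved (`n = k = 1`; the new position `w` near `p`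
is off `S ∖ {p}` by the hard core) says `F(p) ≤ F(w)` for `F(w) = Σ'_{q ∈ S∖{p}} V(|w − q|)` on the ball
`B(p, δ/2)`; `F` is Fréchet-differentiable there by termwise differentiation
(`hasFDerivAt_tsum_of_isPreconnected`, derivative of each term `(V′(d)/d)⟨w − q, ·⟩` from the landed
`ExcessDecayLiouvilleForceBalance.hasFDerivAt_comp_dist_left`, uniform bound `|V′(t)| ≤ C(δ)·|p − q|⁻⁶` on the
ball, summable by `UniformlyDiscrete.summable_of_abs_le_inv_pow_six`); `IsLocalMin.hasFDerivAt_eq_zero` kills the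
derivative, and testing the zero functional against every `z` identifies the vector sum.  [folklore; cf.
BlancLewin2015 §1.2 for finite ground states]
-/

noncomputable section

open Metric Filter Topology
open scoped RealInnerProductSpace

namespace Summit.AtomisticToContinuum.Crystallization.Theorems.PalmUnimodularRigidity.LayeredLawsSelectHcp

open Literature.MathematicalPhysics.StatisticalMechanics
  (lennardJones IsMuGSC UniformlyDiscrete interactionEnergy fieldEnergy interactionEnergy_of_subsingleton)
open Summit.AtomisticToContinuum.Crystallization.Theorems.ExcessDecayLiouvilleForceBalance
  (hasFDerivAt_comp_dist_left differentiableAt_lennardJones)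
open Summit.AtomisticToContinuum.Crystallization.Theorems.PhononStabilityNegative (deriv_lennardJones)

/-- Euclidean `3`-space. [folklore] -/
local notation "E3" => EuclideanSpace ℝ (Fin 3)

/-- `|V_LJ′(t)| ≤ ((ρ⁻¹)⁷ + ρ⁻¹)·t⁻⁶` for `t ≥ ρ > 0` (`V′ = −t⁻¹³ + t⁻⁷`). [folklore] -/
theorem abs_deriv_lennardJones_le_inv_pow_six {ρ t : ℝ} (hρ : 0 < ρ) (ht : ρ ≤ t) :
    |deriv lennardJones t| ≤ ((ρ⁻¹) ^ 7 + ρ⁻¹) * (t⁻¹) ^ 6 := by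
  have ht0 : 0 < t := hρ.trans_le ht
  rw [deriv_lennardJones ht0.ne']
  have h0 : 0 ≤ t⁻¹ := inv_nonneg.2 ht0.le
  have h1 : t⁻¹ ≤ ρ⁻¹ := (inv_le_inv₀ ht0 hρ).2 ht
  have h7 : t⁻¹ ^ 7 ≤ ρ⁻¹ ^ 7 := pow_le_pow_left₀ h0 h1 7
  have h6 : 0 ≤ t⁻¹ ^ 6 := pow_nonneg h0 6
  have e13 : (t⁻¹) ^ 13 = (t⁻¹) ^ 7 * (t⁻¹) ^ 6 := by ring
  have e7 : (t⁻¹) ^ 7 = t⁻¹ * (t⁻¹) ^ 6 := by ring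
  calc |-(t⁻¹) ^ 13 + (t⁻¹) ^ 7| ≤ |-(t⁻¹) ^ 13| + |(t⁻¹) ^ 7| := abs_add_le _ _
    _ = (t⁻¹) ^ 7 * (t⁻¹) ^ 6 + t⁻¹ * (t⁻¹) ^ 6 := by
        rw [abs_neg, abs_of_nonneg (pow_nonneg h0 13), abs_of_nonneg (pow_nonneg h0 7), ← e13, ← e7]
    _ ≤ (ρ⁻¹) ^ 7 * (t⁻¹) ^ 6 + ρ⁻¹ * (t⁻¹) ^ 6 := by gcongr
    _ = ((ρ⁻¹) ^ 7 + ρ⁻¹) * (t⁻¹) ^ 6 := by ring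

/-- The one-particle field: `fieldEnergy V ![w] Y = Σ'_{y ∈ Y} V(|w − y|)`. [folklore] -/
theorem fieldEnergy_single (V : ℝ → ℝ) (w : E3) (Y : Set E3) :
    fieldEnergy V ![w] Y = ∑' y : Y, V (dist w y) := by
  rw [fieldEnergy, Fin.sum_univ_one]
  rfl

/-- `range ![p] = {p}`. [folklore] -/
theorem range_single (p : E3) : Set.range ![p] = {p} := by
  ext x
  simp only [Set.mem_range, Set.mem_singleton_iff]
  constructor
  · rintro ⟨i, rfl⟩
    fin_cases i; rfl
  · rintro rfl; exact ⟨0, rfl⟩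

/-- **Registered sub-goal `tube_muGSC_forceBalance`.**  A `δ`-separated (`δ > 0`) Sütő `μ`GSC of
Lennard-Jones (any chemical potential) is in force balance at every one of its points. [folklore] -/
theorem tube_muGSC_forceBalance :
    ∀ (δ μc : ℝ), 0 < δ → ∀ S : Set E3, (∀ x ∈ S, ∀ y ∈ S, x ≠ y → δ ≤ dist x y) →
      IsMuGSC lennardJones μc S → ∀ p ∈ S,
        HasSum (fun q : {q : E3 // q ∈ S ∧ q ≠ p} =>
          (deriv lennardJones (dist p q.1) / dist p q.1) • (p - q.1)) 0 := by
  intro δ μc hδ S hsep hS p hp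
  -- the punctured configuration and its index type
  set Y : Set E3 := S \ {p} with hY
  have hYS : Y ⊆ S := fun x hx => hx.1
  have hYud : UniformlyDiscrete Y := ⟨δ, hδ, fun x hx y hy hxy => hsep x (hYS hx) y (hYS hy) hxy⟩
  have hfar : ∀ q : Y, δ ≤ dist p q := fun q =>
    hsep p hp q (hYS q.2) fun h => q.2.2 (h ▸ rfl)
  -- the one-particle energy and its termwise derivative on the ball `B(p, δ/2)`
  set U : Set E3 := ball p (δ / 2) with hU
  have hdistU : ∀ w ∈ U, ∀ q : Y, dist p q / 2 ≤ dist w q ∧ δ / 2 ≤ dist w q := by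
    intro w hw q
    have h1 : dist p w < δ / 2 := by rw [dist_comm]; exact mem_ball.1 hw
    have h2 := hfar q
    have h3 : dist p q ≤ dist p w + dist w q := dist_triangle _ _ _
    constructor <;> linarith
  set C : ℝ := ((δ / 2)⁻¹) ^ 7 + (δ / 2)⁻¹ with hC
  have hC0 : 0 ≤ C := by positivity
  set f : Y → E3 → ℝ := fun q w => lennardJones (dist w q) with hf
  set f' : Y → E3 → (E3 →L[ℝ] ℝ) := fun q w =>
    (deriv lennardJones (dist w q) / dist w q) • innerSL ℝ (w - (q : E3)) with hf'
  set u : Y → ℝ := fun q => C * 2 ^ 6 * (dist p q)⁻¹ ^ 6 with hu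
  have hderiv : ∀ (q : Y) (w : E3), w ∈ U → HasFDerivAt (f q) (f' q w) w := by
    intro q w hw
    have hwq : w ≠ (q : E3) := by
      intro h
      have := (hdistU w hw q).2
      rw [h, dist_self] at this
      linarith
    have hne : dist w q ≠ 0 := dist_ne_zero.2 hwq
    exact hasFDerivAt_comp_dist_left hwq (differentiableAt_lennardJones hne).hasDerivAt
  have hbound : ∀ (q : Y) (w : E3), w ∈ U → ‖f' q w‖ ≤ u q := by
    intro q w hw
    obtain ⟨hhalf, hρ⟩ := hdistU w hw q
    have hwq0 : 0 < dist w q := by linarith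
    have hpq0 : 0 < dist p q := by linarith [hfar q]
    have hn : ‖f' q w‖ = |deriv lennardJones (dist w q)| := by
      simp only [hf']
      rw [norm_smul, innerSL_apply_norm, ← dist_eq_norm, Real.norm_eq_abs, abs_div,
        abs_of_pos hwq0, div_mul_cancel₀ _ hwq0.ne']
    rw [hn]
    have h1 := abs_deriv_lennardJones_le_inv_pow_six (by positivity : (0 : ℝ) < δ / 2) hρ
    have h2 : (dist w q)⁻¹ ^ 6 ≤ 2 ^ 6 * (dist p q)⁻¹ ^ 6 := by
      have : (dist w q)⁻¹ ≤ 2 * (dist p q)⁻¹ := by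
        rw [← inv_inv (2 : ℝ), ← mul_inv, inv_le_inv₀ hwq0 (by positivity)]
        linarith
      calc (dist w q)⁻¹ ^ 6 ≤ (2 * (dist p q)⁻¹) ^ 6 :=
            pow_le_pow_left₀ (inv_nonneg.2 hwq0.le) this 6
        _ = 2 ^ 6 * (dist p q)⁻¹ ^ 6 := by ring
    calc |deriv lennardJones (dist w q)| ≤ C * (dist w q)⁻¹ ^ 6 := h1
      _ ≤ C * (2 ^ 6 * (dist p q)⁻¹ ^ 6) := mul_le_mul_of_nonneg_left h2 hC0
      _ = u q := by simp only [hu]; ring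
  have hu_sum : Summable u := by
    have h := hYud.summable_of_abs_le_inv_pow_six (V := fun t => C * 2 ^ 6 * t⁻¹ ^ 6)
      (C := C * 2 ^ 6) (ρ := 1) one_pos (fun t _ => by
        rw [abs_of_nonneg (by positivity)]) p
    exact h
  have hf0 : Summable fun q : Y => f q p := hYud.summable_lennardJones p
  have hpU : p ∈ U := mem_ball_self (by positivity)
  have hF : HasFDerivAt (fun w => ∑' q : Y, f q w) (∑' q : Y, f' q p) p :=
    hasFDerivAt_tsum_of_isPreconnected hu_sum isOpen_ball (convex_ball p (δ / 2)).isPreconnected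
      hderiv hbound hpU hf0 hpU
  -- the exchange test: `F(p) ≤ F(w)` on the ball
  have hmin : IsLocalMin (fun w => ∑' q : Y, f q w) p := by
    have hball : U ∈ 𝓝 p := isOpen_ball.mem_nhds hpU
    refine Filter.eventually_of_mem hball fun w hw => ?_
    -- `w` is off `S ∖ {p}` (hard core), so remove `p` and insert `w`
    have hwY : w ∉ Y := by
      intro hwY'
      have := (hdistU w hw ⟨w, hwY'⟩).2
      simp only [dist_self] at this
      linarith
    have hinj1 : Function.Injective ![p] := Function.injective_of_subsingleton _
    have hinj2 : Function.Injective ![w] := Function.injective_of_subsingleton _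
    have hrange : Set.range ![p] ⊆ S := by rw [range_single]; exact Set.singleton_subset_iff.2 hp
    have hdisj : Disjoint (Set.range ![w]) (S \ Set.range ![p]) := by
      rw [range_single, range_single, Set.disjoint_singleton_left]
      exact hwY
    have h := ((Literature.MathematicalPhysics.StatisticalMechanics.isMuGSC_iff _ _ _).1 hS).2 1 ![p] hinj1 hrange 1 ![w] hinj2 hdisj
    rw [interactionEnergy_of_subsingleton, interactionEnergy_of_subsingleton, range_single] at h
    simp only [Fin.sum_univ_one, Matrix.cons_val_fin_one, Nat.cast_one] at h
    show ∑' q : Y, lennardJones (dist p q) ≤ ∑' q : Y, lennardJones (dist w q)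
    linarith
  -- Fermat: the derivative vanishes
  have hzero : ∑' q : Y, f' q p = 0 := hmin.hasFDerivAt_eq_zero hF
  -- identify the vector sum: `v_q = (V′(d)/d)(p − q)`
  set v : Y → E3 := fun q => (deriv lennardJones (dist p q) / dist p q) • (p - (q : E3)) with hv
  have hv_norm : ∀ q, ‖v q‖ ≤ u q := by
    intro q
    have h := hbound q p hpU
    have hpq0 : 0 < dist p q := by linarith [hfar q]
    have e1 : ‖v q‖ = |deriv lennardJones (dist p q)| := by
      simp only [hv]
      rw [norm_smul, ← dist_eq_norm, Real.norm_eq_abs, abs_div, abs_of_pos hpq0,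
        div_mul_cancel₀ _ hpq0.ne']
    have e2 : ‖f' q p‖ = |deriv lennardJones (dist p q)| := by
      simp only [hf']
      rw [norm_smul, innerSL_apply_norm, ← dist_eq_norm, Real.norm_eq_abs, abs_div,
        abs_of_pos hpq0, div_mul_cancel₀ _ hpq0.ne']
    rw [e1, ← e2]
    exact h
  have hv_sum : Summable v := Summable.of_norm_bounded hu_sum hv_norm
  have hf'_sum : Summable fun q => f' q p := Summable.of_norm_bounded hu_sum fun q => hbound q p hpU
  set s : E3 := ∑' q, v q with hs
  have hinner : ∀ z : E3, ⟪z, s⟫ = 0 := by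
    intro z
    have h1 : HasSum (fun q => ⟪z, v q⟫) ⟪z, s⟫ := (hv_sum.hasSum).mapL (innerSL ℝ z)
    have h2 : HasSum (fun q => f' q p z) ((∑' q : Y, f' q p) z) :=
      (hf'_sum.hasSum).mapL (ContinuousLinearMap.apply ℝ ℝ z)
    rw [hzero] at h2
    simp only [FunLike.coe_zero, Pi.zero_apply] at h2
    have h3 : (fun q => f' q p z) = fun q => ⟪z, v q⟫ := by
      funext q
      simp only [hf', hv, FunLike.coe_smul, Pi.smul_apply, innerSL_apply_apply, smul_eq_mul,
        inner_smul_right]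
      rw [real_inner_comm]
    rw [h3] at h2
    exact h1.unique h2
  have hs0 : s = 0 := by
    have := hinner s
    exact inner_self_eq_zero.1 this
  have hmain : HasSum v 0 := by rw [← hs0]; exact hv_sum.hasSum
  exact hmain

end Summit.AtomisticToContinuum.Crystallization.Theorems.PalmUnimodularRigidity.LayeredLawsSelectHcp

end
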